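import Summits.MatrixMultiplication.MatrixMultiplication.Theorems.SaturationLadderLittleCwThin
import HarnessLib

/-!
# Route `SaturationLadder` — EXACTNESS CRITERION for the first-power little-CW certificate (decomp-mm lens 1
«grading / quantitative ladder», gen 24; chain file 3, support helper beneath crux `SubexpSaturation`)

The general-shape certificate `SaturationLadderLittleCwRect.littleCwRectBound` bounds, for `a = min(a,b,c)`,
`S = a + b + c`, `p = a/S` and `R̃(cw_q) ≤ q + 1 + η`,
  `ω(a, b, c) ≤ V := S·(log(q+1+η) − h(p))/log q`,
while the flattening (information) lower bound is `ω(a,b,c) ≥ b + c = S(1 − p)`.  This file decides EXACTLY when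
the certificate meets the lower bound, i.e. when the first-power little-CW method certifies an exact tight point:

* `binEntropy_add_mul_log_le` — the Gibbs inequality `h(p) + (1 − p) log q ≤ log(q+1)` on `[0,1]` (`q > 0`),
  the deficit being the Kullback–Leibler divergence of `(p, 1−p)` from `(1/(q+1), q/(q+1))`;
* `binEntropy_add_mul_log_eq_iff` — equality iff `p = 1/(q+1)` (`q ≥ 1`; strictness of `log u ≤ u − 1`);
* `littleCwCert_ge` — `V − S(1−p) ≥ S·(log(q+1+η) − log(q+1))/log q ≥ 0`: the certificate never beats
  flattening, and for `η > 0` it stays a definite `S·log(1 + η/(q+1))/log q` above it at EVERY type;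
* `littleCwCert_eq_iff` — **`V = S(1 − p)` iff `η = 0 ∧ (q+1)·a = S`**, i.e. iff the little CW tensor is FLAT and
  the type lies on the SEGMENT `b + c = q·a` of chain file 2 (`SaturationLadderLittleCwThin.omegaRect_segment_eq_of_flat`,
  where the segment is indeed exactly tight).  So, graded by the deficiency `η_q = R̃(cw_q) − (q+1)`, the
  first power of `cw_q` produces thin tight points (the currency of crux `SubexpSaturation`,
  stmt-MatrixMultiplication-25909) at grade `η_q = 0` and at no positive grade — the dictionary of chain file 2 is
  two-sided at the level of the certificate.  (A statement about the certificate's VALUE, not about `ω`: other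
  designs — higher powers of `cw_q`, the big tensor `CW_q` of `SaturationLadderExpSaturation` — are not covered.)
Pure real analysis on explicit functions; no definitions, no named facts, no sorry.
[cite: CoppersmithWinograd1990, §6; BurgisserClausenShokrollahi1997, Thm. 15.41; CoverThomas2006, Thm. 2.6.3]
-/

set_option linter.dupNamespace false

noncomputable section

namespace Summit.MatrixMultiplication.MatrixMultiplication.Theorems.SaturationLadderLittleCwGibbs

open Literature.Computability.AlgebraicComplexity
open Summit.MatrixMultiplication.MatrixMultiplication.Theorems.SaturationLadderLittleCwThin (binEntropy_base)

/-! ## The Gibbs inequality `h(p) + (1−p) log q ≤ log(q+1)` and its equality case -/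

/-- For `0 < p < 1`, `q > 0`: the deficit identity behind Gibbs,
`h(p) + (1−p) log q − log(q+1) = p·log(1/(p(q+1))) + (1−p)·log(q/((1−p)(q+1)))`. -/
theorem binEntropy_add_mul_log_sub_eq {p q : ℝ} (hp0 : 0 < p) (hp1 : p < 1) (hq : 0 < q) :
    Real.binEntropy p + (1 - p) * Real.log q - Real.log (q + 1) =
      p * Real.log (1 / (p * (q + 1))) + (1 - p) * Real.log (q / ((1 - p) * (q + 1))) := by
  have hq1 : 0 < q + 1 := by linarith
  have h1p : 0 < 1 - p := by linarith
  rw [Real.binEntropy, Real.log_inv, Real.log_inv, one_div, Real.log_inv, Real.log_mul hp0.ne' hq1.ne',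
    Real.log_div hq.ne' (mul_pos h1p hq1).ne', Real.log_mul h1p.ne' hq1.ne']
  ring

/-- **Gibbs inequality** (two-point form): `h(p) + (1 − p)·log q ≤ log(q + 1)` for `0 ≤ p ≤ 1`, `q > 0` —
`max_p [h(p) + (1−p) log q] = log(q+1)`, the log-sum-exp of the weights `(1, q)`. [cite: CoverThomas2006, Thm. 2.6.3] -/
theorem binEntropy_add_mul_log_le {p q : ℝ} (hp0 : 0 ≤ p) (hp1 : p ≤ 1) (hq : 0 < q) :
    Real.binEntropy p + (1 - p) * Real.log q ≤ Real.log (q + 1) := by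
  have hq1 : 0 < q + 1 := by linarith
  rcases hp0.eq_or_lt with h0 | h0
  · -- `p = 0`: `log q ≤ log(q+1)`
    rw [← h0, Real.binEntropy_zero, zero_add, sub_zero, one_mul]
    exact Real.log_le_log hq (by linarith)
  rcases hp1.eq_or_lt with h1 | h1
  · -- `p = 1`: `0 ≤ log(q+1)`
    rw [h1, Real.binEntropy_one, sub_self, zero_mul, add_zero]
    exact Real.log_nonneg (by linarith)
  have h1p : 0 < 1 - p := by linarith
  have hu1 : 0 < 1 / (p * (q + 1)) := by positivity
  have hu2 : 0 < q / ((1 - p) * (q + 1)) := by positivity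
  have hl1 := Real.log_le_sub_one_of_pos hu1
  have hl2 := Real.log_le_sub_one_of_pos hu2
  have e1 : p * (1 / (p * (q + 1))) = 1 / (q + 1) := by field_simp
  have e2 : (1 - p) * (q / ((1 - p) * (q + 1))) = q / (q + 1) := by field_simp
  have e3 : 1 / (q + 1) + q / (q + 1) = 1 := by
    rw [← add_div, add_comm]
    exact div_self hq1.ne'
  have hm1 := mul_le_mul_of_nonneg_left hl1 h0.le
  have hm2 := mul_le_mul_of_nonneg_left hl2 h1p.le
  have hid := binEntropy_add_mul_log_sub_eq h0 h1 hq
  nlinarith [hm1, hm2, e1, e2, e3, hid]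

/-- **Equality case of Gibbs**: for `0 ≤ p ≤ 1`, `q ≥ 1`,
`h(p) + (1 − p)·log q = log(q + 1) ↔ p = 1/(q+1)` (strictness of `log u < u − 1` off `u = 1`; the value at
`p = 1/(q+1)` is `binEntropy_base`). -/
theorem binEntropy_add_mul_log_eq_iff {p q : ℝ} (hp0 : 0 ≤ p) (hp1 : p ≤ 1) (hq : 1 ≤ q) :
    Real.binEntropy p + (1 - p) * Real.log q = Real.log (q + 1) ↔ p = 1 / (q + 1) := by
  have hq0 : 0 < q := by linarith
  have hq1 : 0 < q + 1 := by linarith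
  constructor
  · intro heq
    rcases hp0.eq_or_lt with h0 | h0
    · -- `p = 0`: `log q < log(q+1)`
      exfalso
      rw [← h0, Real.binEntropy_zero, zero_add, sub_zero, one_mul] at heq
      have := Real.log_lt_log hq0 (by linarith : q < q + 1)
      linarith
    rcases hp1.eq_or_lt with h1 | h1
    · -- `p = 1`: `0 < log(q+1)`
      exfalso
      rw [h1, Real.binEntropy_one, sub_self, zero_mul, add_zero] at heq
      have := Real.log_pos (by linarith : 1 < q + 1)
      linarith
    by_contra hne
    have h1p : 0 < 1 - p := by linarith
    have hu1 : 0 < 1 / (p * (q + 1)) := by positivity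
    have hu2 : 0 < q / ((1 - p) * (q + 1)) := by positivity
    have hu1' : 1 / (p * (q + 1)) ≠ 1 := by
      intro h
      apply hne
      have : p * (q + 1) = 1 := by
        have hne0 : p * (q + 1) ≠ 0 := by positivity
        field_simp at h
        linarith
      field_simp
      linarith
    have hl1 := Real.log_lt_sub_one_of_pos hu1 hu1'
    have hl2 := Real.log_le_sub_one_of_pos hu2
    have e1 : p * (1 / (p * (q + 1))) = 1 / (q + 1) := by field_simp
    have e2 : (1 - p) * (q / ((1 - p) * (q + 1))) = q / (q + 1) := by field_simp
    have e3 : 1 / (q + 1) + q / (q + 1) = 1 := by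
      rw [← add_div, add_comm]
      exact div_self hq1.ne'
    have hm1 := mul_lt_mul_of_pos_left hl1 h0
    have hm2 := mul_le_mul_of_nonneg_left hl2 h1p.le
    have hid := binEntropy_add_mul_log_sub_eq h0 h1 hq0
    nlinarith [hm1, hm2, e1, e2, e3, hid]
  · intro hp
    have hb := binEntropy_base q hq
    -- `(q+1) h(1/(q+1)) = (q+1) log(q+1) − q log q`, and `(1 − 1/(q+1)) = q/(q+1)`
    rw [hp]
    have e : (1 - 1 / (q + 1)) * Real.log q = q / (q + 1) * Real.log q := by
      congr 1
      field_simp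
      ring
    rw [e]
    have hb' : Real.binEntropy (1 / (q + 1)) = Real.log (q + 1) - q / (q + 1) * Real.log q := by
      field_simp
      linarith [hb]
    rw [hb']
    ring

/-! ## The certificate against the flattening bound -/

/-- **The first-power little-CW certificate never beats flattening, and misses it by at least
`S·(log(q+1+η) − log(q+1))/log q` at every type.**  For `q ≥ 2`, `S > 0`, `0 ≤ p ≤ 1` and any real `η`
(the gap term is nonnegative exactly when `η ≥ 0`):
`S(1−p) + S(log(q+1+η) − log(q+1))/log q ≤ S(log(q+1+η) − h(p))/log q`. -/
theorem littleCwCert_ge {q S p : ℝ} (η : ℝ) (hq : 2 ≤ q) (hS : 0 < S) (hp0 : 0 ≤ p) (hp1 : p ≤ 1) :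
    S * (1 - p) + S * (Real.log (q + 1 + η) - Real.log (q + 1)) / Real.log q ≤
      S * (Real.log (q + 1 + η) - Real.binEntropy p) / Real.log q := by
  have hlogq : 0 < Real.log q := Real.log_pos (by linarith)
  have hg := binEntropy_add_mul_log_le hp0 hp1 (by linarith : 0 < q)
  rw [← sub_nonneg]
  have e : S * (Real.log (q + 1 + η) - Real.binEntropy p) / Real.log q -
      (S * (1 - p) + S * (Real.log (q + 1 + η) - Real.log (q + 1)) / Real.log q) =
      S * (Real.log (q + 1) - (Real.binEntropy p + (1 - p) * Real.log q)) / Real.log q := by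
    field_simp
    ring
  rw [e]
  exact div_nonneg (mul_nonneg hS.le (by linarith)) hlogq.le

/-- Corollary: `S(1−p) ≤ V` (`V` the certificate value), with the explicit positive gap
`S·log(1 + η/(q+1))/log q` whenever `η > 0`. -/
theorem littleCwCert_gt_of_pos {q η S p : ℝ} (hq : 2 ≤ q) (hη : 0 < η) (hS : 0 < S) (hp0 : 0 ≤ p)
    (hp1 : p ≤ 1) : S * (1 - p) < S * (Real.log (q + 1 + η) - Real.binEntropy p) / Real.log q := by
  have h := littleCwCert_ge η hq hS hp0 hp1
  have hlogq : 0 < Real.log q := Real.log_pos (by linarith)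
  have hgap : 0 < S * (Real.log (q + 1 + η) - Real.log (q + 1)) / Real.log q := by
    have : Real.log (q + 1) < Real.log (q + 1 + η) := Real.log_lt_log (by linarith) (by linarith)
    exact div_pos (mul_pos hS (by linarith)) hlogq
  linarith

/-- **Exactness criterion.**  For `q ≥ 2`, `η ≥ 0`, `S > 0`, `0 ≤ p ≤ 1`: the certificate value equals the
flattening bound, `S(log(q+1+η) − h(p))/log q = S(1 − p)`, iff `η = 0 ∧ p = 1/(q+1)` — the little CW tensor
is flat AND the type lies on the segment `b + c = q·a` of `SaturationLadderLittleCwThin`. -/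
theorem littleCwCert_eq_iff {q η S p : ℝ} (hq : 2 ≤ q) (hη : 0 ≤ η) (hS : 0 < S) (hp0 : 0 ≤ p) (hp1 : p ≤ 1) :
    S * (Real.log (q + 1 + η) - Real.binEntropy p) / Real.log q = S * (1 - p) ↔ η = 0 ∧ p = 1 / (q + 1) := by
  have hlogq : 0 < Real.log q := Real.log_pos (by linarith)
  constructor
  · intro heq
    have hη0 : η = 0 := by
      by_contra hne
      have hpos : 0 < η := lt_of_le_of_ne hη (Ne.symm hne)
      have := littleCwCert_gt_of_pos hq hpos hS hp0 hp1
      linarith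
    refine ⟨hη0, ?_⟩
    rw [hη0, add_zero] at heq
    -- `S (log(q+1) − h(p)) = S (1−p) log q` ⟹ Gibbs equality
    have h2 : Real.log (q + 1) - Real.binEntropy p = (1 - p) * Real.log q := by
      have h3 : S * (Real.log (q + 1) - Real.binEntropy p) = S * (1 - p) * Real.log q := by
        rw [div_eq_iff hlogq.ne'] at heq
        exact heq
      have h4 : S * (Real.log (q + 1) - Real.binEntropy p - (1 - p) * Real.log q) = 0 := by linarith
      rcases mul_eq_zero.1 h4 with h5 | h5
      · exact absurd h5 hS.ne'
      · linarith
    exact (binEntropy_add_mul_log_eq_iff hp0 hp1 (by linarith)).1 (by linarith)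
  · rintro ⟨hη0, hp⟩
    have hg := (binEntropy_add_mul_log_eq_iff hp0 hp1 (by linarith : 1 ≤ q)).2 hp
    rw [hη0, add_zero, div_eq_iff hlogq.ne']
    have : Real.log (q + 1) - Real.binEntropy p = (1 - p) * Real.log q := by linarith
    rw [this]
    ring

/-- The criterion in the integer currency of `littleCwRectBound` (`S = a + b + c`, `p = a/S`): the right-hand
side of `littleCwRectBound q a b c … (q+1+η) …` equals the flattening bound `b + c` iff `η = 0 ∧ b + c = q·a`. -/
theorem littleCwRectBound_rhs_eq_iff (q a b c : ℕ) (hq : 2 ≤ q) (ha : 1 ≤ a) {η : ℝ} (hη : 0 ≤ η) :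
    ((a : ℝ) + b + c) * (Real.log ((q : ℝ) + 1 + η) - Real.binEntropy ((a : ℝ) / ((a : ℝ) + b + c))) /
        Real.log (q : ℝ) = (b : ℝ) + c ↔ η = 0 ∧ b + c = q * a := by
  have hq2 : (2 : ℝ) ≤ q := by exact_mod_cast hq
  have ha0 : (0 : ℝ) < a := by exact_mod_cast ha
  have hS : (0 : ℝ) < (a : ℝ) + b + c := by positivity
  have hp0 : (0 : ℝ) ≤ (a : ℝ) / ((a : ℝ) + b + c) := by positivity
  have hp1 : (a : ℝ) / ((a : ℝ) + b + c) ≤ 1 := by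
    rw [div_le_one hS]
    have : (0 : ℝ) ≤ (b : ℝ) + c := by positivity
    linarith
  have hbc : ((a : ℝ) + b + c) * (1 - (a : ℝ) / ((a : ℝ) + b + c)) = (b : ℝ) + c := by
    field_simp
    ring
  have key := littleCwCert_eq_iff (S := (a : ℝ) + b + c) (p := (a : ℝ) / ((a : ℝ) + b + c)) hq2 hη hS hp0 hp1
  rw [hbc] at key
  rw [key]
  have hseg : (a : ℝ) / ((a : ℝ) + b + c) = 1 / ((q : ℝ) + 1) ↔ b + c = q * a := by
    rw [div_eq_div_iff hS.ne' (by positivity), one_mul]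
    constructor
    · intro h
      have h' : ((b + c : ℕ) : ℝ) = ((q * a : ℕ) : ℝ) := by push_cast; linarith
      exact_mod_cast h'
    · intro h
      have h' : ((b + c : ℕ) : ℝ) = ((q * a : ℕ) : ℝ) := by rw [h]
      push_cast at h'
      linarith
  rw [hseg]

end Summit.MatrixMultiplication.MatrixMultiplication.Theorems.SaturationLadderLittleCwGibbs
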